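import Literature.Probability.FitznerVanDerHofstad2017.NobleCodingLevelZero
import Literature.Probability.FitznerVanDerHofstad2017.NobleBoundingEventsIota
import Literature.Barriers.CriticalPhenomena.GaussianDominationRouteLaceExpansionToggle
import HarnessLib

/-!
# [FvdH17] §4.4 (4.66)/(4.67)/(4.69), level `0` of `Ξ^{b_ι}(0,x;{e_ι})`: the CODING of the cell
# `E'(0,y;{e})` INSIDE `C̃₀`, with its canonical side facts, PROVED

Source: R. Fitzner, R. van der Hofstad, *Mean-field behavior for nearest-neighbor percolation in
`d > 10`*, Electron. J. Probab. **22** (2017) no. 43 [FvdH17]; arXiv:1506.07977v2 (page numbers below),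
LaTeX source `PercPaper_arxiv2017.tex` (TeX line numbers `l.`).

* (4.66)/(4.67) (v2 p. 44; EJP p. 40; TeX l.9135–9143): the bounding events
  `F^{ι,I}_0(b₀,w₀,z₁) = {0 ↔ e_ι} ∘ {e_ι ↔ w₀} ∘ {w₀ ↔ b̲₀} ∘ {w₀ ↔ z₁} ∘ {e_ι ↔ b̲₀} ∩ …` and
  `F^{ι,II}_0(b₀,w₀,z₁) = {0 ↔ w₀} ∘ {w₀ ↔ e_ι} ∘ {e_ι ⇔ b̲₀} ∘ {w₀ ↔ z₁} ∩ {w₀ ≠ e_ι} ∩ …`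
  (`eventFiotaI` / `eventFiotaII` of `NobleBoundingEvents`).
* (4.69) and the text after it (v2 p. 44; TeX l.9152–9160): "if `E'(0,b̲₀;{e_ι})₀` occurs, then there
  exists a path of occupied bonds from `0` to `e_ι`.  As `e_ι` cuts the connection `0 ↔ b̲₀`, either
  `b̲₀ = e_ι` or `e_ι` and `b̲₀` are connected by a sausage.  We denote by `w₀` the last point that the
  connections `0 ↔ b̲₀` and `0 ↔ z₁` share.  If `w₀` is on the last sausage, then the event is part of
  `F^{ι,I}_0` and otherwise part of `F^{ι,II}_0`."
* §4.4 after (4.65) (v2 p. 43; TeX l.9113–9118): the coded paths may be chosen inside `C̃₀` and pairwise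
  bond-disjoint ("all paths involved in the above connections are bond disjoint, even when they occur in
  different levels").
* §6.1, proof of Lemma 5.3 (v2 p. 59; TeX l.10083–10104), the side facts of the coding used by the tables
  `P^{ι,a}(u,w)`: for `F^{ι,I}_0` "if `u = e_ι` the sausage is trivial and `w = e_ι`"; for `F^{ι,II}_0`
  "`w ≠ e_ι`", `w` is off the sausage (so `w ≠ u`), and "`F^{ι,II}_0` can occur for `a = 1` only when
  `u = e_ι`" (an occupied bond `(u,w)` with `u ≠ e_ι` would join `0` to `u` around `e_ι`).

What this module proves (deterministic; the `A = {e}` twin of `NobleCodingLevelZero`).  For a configuration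
`ω ⊆` bonds of `ℤ^d` with `ω ∈ E'(0,y;{e})`, `y' ∉ C̃₀ := C̃^{(y,y')}(0)` and `z ∈ C̃₀`:

* `sdiff_mem_laceE_of_notMem` — `E'(0,y;A)` survives the restriction to `ω ∖ {(y,y')}` (no open `0`–`y`
  path uses `(y,y')`, `NobleCodingLevelZero.notMem_edges_of_notMem_restrCluster`, and `laceE_sdiff_iff`);
  `mem_support_of_mem_laceE_singleton` — every open `0`–`y` walk visits `e`;
* `exists_laceCodingι` — the CODING: a vertex `w` and EITHER (`LaceCodingιI`, `w` on the last sausage)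
  five pairwise edge-disjoint walks `0 → e`, `e → w`, `w → y`, `w → z`, `e → y`, with `y = e → w = e`, OR
  (`LaceCodingιII`, `w` before the sausage) five pairwise edge-disjoint walks `0 → w`, `w → e`, `e → y`,
  `e → y`, `w → z`, with `w ≠ e`, `w ≠ y` and "the bond `(y,w)` open only if `y = e`"; all walks open in
  `ω ∖ {(y,y')}`, so every vertex and bond of them lies in `C̃₀`
  (`LaceCodingιI/II.mem_restrCluster_of_mem_support/edges`) — the membership the level-`1` off-`C̃₀`
  clause of `NobleCodingLevelOne` is matched against;
* `LaceCodingιI.mem_eventFiotaI`, `LaceCodingιII.mem_eventFiotaII` — in particular (4.66)/(4.67) occur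
  when `z ∉ b₀` and `b_ι = (0,e)` is vacant (the single-level reading `exists_mem_eventFiota_of_mem_laceE`
  of `NobleBoundingEventsIota`, now with the canonical side facts).

The construction: Menger's sausage `B : 0 → t`, `P, Q : t → y` of `E'(0,y;{e})` in `ω ∖ {(y,y')}`
(`exists_sausage_of_mem_laceE`), both branches through `e`; `R :=` a simple `0 → e` path inside `B·P|_{t→e}`,
`S₁ := P|_{e→y}`, `S₂ := Q|_{e→y}`; `w :=` the last vertex of an open `0 → z` path of `C̃₀` on
`R ∪ S₁ ∪ S₂`; `w ∈ S₁ ∪ S₂` gives `F^{ι,I}_0`, `w ∈ R ∖ (S₁ ∪ S₂)` gives `F^{ι,II}_0`.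
Nothing here is a cited hypothesis; everything is kernel-proved for arbitrary `ω`; no numeral, no dimension.

## References
* [FvdH17] arXiv:1506.07977v2 (4.66)–(4.69) p. 44, §4.4 p. 43 (after (4.65)), §6.1 p. 59; EJP 22 (2017)
  no. 43 pp. 40–41, 55–56.
* [HvdH17] M. Heydenreich, R. van der Hofstad, *Progress in high-dimensional percolation and random graphs*
  (Springer 2017), (7.2.24), (7.3.2).
-/

namespace Literature.Probability.FitznerVanDerHofstad2017

open Literature.Barriers.CriticalPhenomena Literature.Probability.Percolation
open Literature.Probability.LatticeModels Literature.Combinatorics.SimpleGraph _root_.SimpleGraph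

variable {d : ℕ}

/-! ### A. The cell `E'(0,y;A) ∩ {y' ∉ C̃₀}` survives the restriction to `ω ∖ {(y,y')}` -/

/-- `b̲₀ = y ∈ C̃^{(y,y')}(0)`: an open `0`–`y` path does not use `(y,y')` when `y' ∉ C̃^{(y,y')}(0)`.
[cite: FitznerVanDerHofstad2017, (3.25)–(3.27) (arXiv:1506.07977v2 pp. 25–27)] -/
theorem mem_restrCluster_of_mem_laceE_of_notMem {ω : BondConfig (Site d)} {A : Set (Site d)} {y y' : Site d}
    (hE : ω ∈ laceE A 0 y) (hy' : y' ∉ restrCluster y y' 0 ω) : y ∈ restrCluster y y' 0 ω := by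
  classical
  obtain ⟨p, hp⟩ :=
    (show (openGraph ω).Reachable 0 y from laceE_subset_openConn A 0 y hE).exists_isPath
  exact (mem_restrCluster_iff y y' 0 y ω).2
    (reachable_sdiff_of_walk p (notMem_edges_of_notMem_restrCluster hy' p hp))

/-- **`E'(0,y;A)` survives the restriction**: in the cell (`y' ∉ C̃^{(y,y')}(0)`),
`ω ∖ {(y,y')} ∈ E'(0,y;A)`. [cite: FitznerVanDerHofstad2017, (3.25)–(3.27) and §4.4 after (4.65) (arXiv:1506.07977v2 pp. 25–27, 43)] -/
theorem sdiff_mem_laceE_of_notMem {ω : BondConfig (Site d)} {A : Set (Site d)} {y y' : Site d}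
    (hE : ω ∈ laceE A 0 y) (hy' : y' ∉ restrCluster y y' 0 ω) : ω \ {s(y, y')} ∈ laceE A 0 y :=
  (laceE_sdiff_iff (mem_restrCluster_of_mem_laceE_of_notMem hE hy') hy' A).2 hE

/-- **`e` cuts `0 ↔ y`**: in `E'(0,y;{e})` every open `0`–`y` walk visits `e`.
[cite: FitznerVanDerHofstad2017, (3.24) and text after (4.69) (arXiv:1506.07977v2 pp. 25, 44)] -/
theorem mem_support_of_mem_laceE_singleton {ω : BondConfig (Site d)} {e y : Site d}
    (hE : ω ∈ laceE {e} 0 y) (q : (openGraph ω).Walk 0 y) : e ∈ q.support := by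
  by_contra h
  obtain ⟨⟨-, hnot⟩, -⟩ := (mem_laceE_iff {e} 0 y ω).1 hE
  exact hnot (openConnIn_of_walk q fun x hx hxe => h ((Set.mem_singleton_iff.1 hxe) ▸ hx))

/-- Both endpoints of every bond of an open walk of `ω ∖ {(y,y')}` starting in `C̃^{(y,y')}(0)` lie in
`C̃^{(y,y')}(0)` (file-private plumbing). [folklore] -/
private theorem mem_restrCluster_of_mem_edges_of_walk {ω : BondConfig (Site d)} {y y' a c : Site d}
    (W : (openGraph (ω \ {s(y, y')})).Walk a c) (ha : a ∈ restrCluster y y' 0 ω) :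
    ∀ b ∈ W.edges, ∀ x ∈ b, x ∈ restrCluster y y' 0 ω := by
  intro b hb
  induction b using Sym2.ind with
  | h x₁ x₂ =>
    intro x hx
    rcases Sym2.mem_iff.1 hx with rfl | rfl
    · exact LaceCoding₀.mem_restrCluster_of_walk W ha _ (W.fst_mem_support_of_mem_edges hb)
    · exact LaceCoding₀.mem_restrCluster_of_walk W ha _ (W.snd_mem_support_of_mem_edges hb)

/-! ### B. The two codings of level `0` -/

/-- The CODING `F^{ι,I}_0` (`w` on the last sausage `e ⇒ y`): five pairwise edge-disjoint walks
`0 → e`, `e → w`, `w → y`, `w → z`, `e → y` (the order of (4.66)), open in `ω ∖ {(y,y')}`, with the canonical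
fact "if `y = e` the sausage is trivial and `w = e`".
[cite: FitznerVanDerHofstad2017, (4.66) and text after (4.69) (arXiv:1506.07977v2 p. 44); §6.1 proof of Lemma 5.3, Case a = 0 (p. 59)] -/
structure LaceCodingιI (ω : BondConfig (Site d)) (e y y' w z : Site d) where
  /-- `{0 ↔ e_ι}` -/
  W₁ : (openGraph (ω \ {s(y, y')})).Walk 0 e
  /-- `{e_ι ↔ w₀}` -/
  W₂ : (openGraph (ω \ {s(y, y')})).Walk e w
  /-- `{w₀ ↔ b̲₀}` -/
  W₃ : (openGraph (ω \ {s(y, y')})).Walk w y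
  /-- `{w₀ ↔ z₁}` -/
  W₄ : (openGraph (ω \ {s(y, y')})).Walk w z
  /-- `{e_ι ↔ b̲₀}` (the other branch of the sausage) -/
  W₅ : (openGraph (ω \ {s(y, y')})).Walk e y
  d₁₂ : List.Disjoint W₁.edges W₂.edges
  d₁₃ : List.Disjoint W₁.edges W₃.edges
  d₁₄ : List.Disjoint W₁.edges W₄.edges
  d₁₅ : List.Disjoint W₁.edges W₅.edges
  d₂₃ : List.Disjoint W₂.edges W₃.edges
  d₂₄ : List.Disjoint W₂.edges W₄.edges
  d₂₅ : List.Disjoint W₂.edges W₅.edges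
  d₃₄ : List.Disjoint W₃.edges W₄.edges
  d₃₅ : List.Disjoint W₃.edges W₅.edges
  d₄₅ : List.Disjoint W₄.edges W₅.edges
  /-- "if `u = e_ι` the sausage is trivial and `w = e_ι`" -/
  canon : y = e → w = e

/-- The CODING `F^{ι,II}_0` (`w` before the last sausage): five pairwise edge-disjoint walks
`0 → w`, `w → e`, `e → y`, `e → y`, `w → z` (the order of (4.67)), open in `ω ∖ {(y,y')}`, with the canonical
facts `w ≠ e`, `w ≠ y` (`w` is off the sausage) and "the bond `(y,w)` is open only when `y = e_ι`".
[cite: FitznerVanDerHofstad2017, (4.67) and text after (4.69) (arXiv:1506.07977v2 p. 44); §6.1 proof of Lemma 5.3, Case a = 1 (p. 59)] -/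
structure LaceCodingιII (ω : BondConfig (Site d)) (e y y' w z : Site d) where
  /-- `{0 ↔ w₀}` -/
  W₁ : (openGraph (ω \ {s(y, y')})).Walk 0 w
  /-- `{w₀ ↔ e_ι}` -/
  W₂ : (openGraph (ω \ {s(y, y')})).Walk w e
  /-- `{e_ι ↔ b̲₀}`, first route -/
  W₃ : (openGraph (ω \ {s(y, y')})).Walk e y
  /-- `{e_ι ↔ b̲₀}`, second route -/
  W₄ : (openGraph (ω \ {s(y, y')})).Walk e y
  /-- `{w₀ ↔ z₁}` -/
  W₅ : (openGraph (ω \ {s(y, y')})).Walk w z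
  d₁₂ : List.Disjoint W₁.edges W₂.edges
  d₁₃ : List.Disjoint W₁.edges W₃.edges
  d₁₄ : List.Disjoint W₁.edges W₄.edges
  d₁₅ : List.Disjoint W₁.edges W₅.edges
  d₂₃ : List.Disjoint W₂.edges W₃.edges
  d₂₄ : List.Disjoint W₂.edges W₄.edges
  d₂₅ : List.Disjoint W₂.edges W₅.edges
  d₃₄ : List.Disjoint W₃.edges W₄.edges
  d₃₅ : List.Disjoint W₃.edges W₅.edges
  d₄₅ : List.Disjoint W₄.edges W₅.edges
  /-- "`w₀ ≠ e_ι`" -/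
  ne : w ≠ e
  /-- `w` is off the sausage `e_ι ⇒ b̲₀`, in particular `w ≠ b̲₀` -/
  ne_end : w ≠ y
  /-- "`F^{ι,II}_0` can occur for `a = 1` only when `u = e_ι`": the bond `(y,w)` is open only if `y = e` -/
  canon : s(y, w) ∈ ω \ {s(y, y')} → y = e

namespace LaceCodingιI

variable {ω : BondConfig (Site d)} {e y y' w z : Site d}

/-- `e_ι ∈ C̃₀`. [cite: FitznerVanDerHofstad2017, §4.4 after (4.65) (arXiv:1506.07977v2 p. 43)] -/
theorem e_mem (c : LaceCodingιI ω e y y' w z) : e ∈ restrCluster y y' 0 ω :=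
  LaceCoding₀.mem_restrCluster_of_walk c.W₁ (LaceCoding₀.zero_mem_restrCluster ω y y') e c.W₁.end_mem_support

/-- `w₀ ∈ C̃₀`. [cite: FitznerVanDerHofstad2017, §4.4 after (4.65) (arXiv:1506.07977v2 p. 43)] -/
theorem w_mem (c : LaceCodingιI ω e y y' w z) : w ∈ restrCluster y y' 0 ω :=
  LaceCoding₀.mem_restrCluster_of_walk c.W₂ c.e_mem w c.W₂.end_mem_support

/-- **All five coded connections live inside `C̃₀`** (vertices).
[cite: FitznerVanDerHofstad2017, §4.4 after (4.65) (arXiv:1506.07977v2 p. 43)] -/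
theorem mem_restrCluster_of_mem_support (c : LaceCodingιI ω e y y' w z) (x : Site d)
    (hx : x ∈ c.W₁.support ∨ x ∈ c.W₂.support ∨ x ∈ c.W₃.support ∨ x ∈ c.W₄.support ∨ x ∈ c.W₅.support) :
    x ∈ restrCluster y y' 0 ω := by
  rcases hx with hx | hx | hx | hx | hx
  · exact LaceCoding₀.mem_restrCluster_of_walk c.W₁ (LaceCoding₀.zero_mem_restrCluster ω y y') x hx
  · exact LaceCoding₀.mem_restrCluster_of_walk c.W₂ c.e_mem x hx
  · exact LaceCoding₀.mem_restrCluster_of_walk c.W₃ c.w_mem x hx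
  · exact LaceCoding₀.mem_restrCluster_of_walk c.W₄ c.w_mem x hx
  · exact LaceCoding₀.mem_restrCluster_of_walk c.W₅ c.e_mem x hx

/-- **All five coded connections live inside `C̃₀`** (bonds: both endpoints of every bond used).
[cite: FitznerVanDerHofstad2017, §4.4 after (4.65) (arXiv:1506.07977v2 p. 43)] -/
theorem mem_restrCluster_of_mem_edges (c : LaceCodingιI ω e y y' w z) (b : Sym2 (Site d))
    (hb : b ∈ c.W₁.edges ∨ b ∈ c.W₂.edges ∨ b ∈ c.W₃.edges ∨ b ∈ c.W₄.edges ∨ b ∈ c.W₅.edges) :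
    ∀ x ∈ b, x ∈ restrCluster y y' 0 ω := by
  rcases hb with hb | hb | hb | hb | hb
  · exact mem_restrCluster_of_mem_edges_of_walk c.W₁ (LaceCoding₀.zero_mem_restrCluster ω y y') b hb
  · exact mem_restrCluster_of_mem_edges_of_walk c.W₂ c.e_mem b hb
  · exact mem_restrCluster_of_mem_edges_of_walk c.W₃ c.w_mem b hb
  · exact mem_restrCluster_of_mem_edges_of_walk c.W₄ c.w_mem b hb
  · exact mem_restrCluster_of_mem_edges_of_walk c.W₅ c.e_mem b hb

/-- `w ≠ y'` and `z ≠ y'` when `y' ∉ C̃₀`. [cite: FitznerVanDerHofstad2017, (4.66) clause `z₁ ∉ b₀` (arXiv:1506.07977v2 p. 44)] -/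
theorem ne_of_notMem (c : LaceCodingιI ω e y y' w z) (hy' : y' ∉ restrCluster y y' 0 ω) : w ≠ y' ∧ z ≠ y' :=
  ⟨fun h => hy' (h ▸ c.w_mem),
   fun h => hy' (h ▸ LaceCoding₀.mem_restrCluster_of_walk c.W₄ c.w_mem z c.W₄.end_mem_support)⟩

/-- The five coded connections occur disjointly in `ω ∖ {(y,y')}`.
[cite: FitznerVanDerHofstad2017, (4.66) (arXiv:1506.07977v2 p. 44)] -/
theorem sdiff_mem_disjointOccurrenceList (c : LaceCodingιI ω e y y' w z) :
    ω \ {s(y, y')} ∈ disjointOccurrenceList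
      [openConn 0 e, openConn e w, openConn w y, openConn w z, (openConn e y : Set (BondConfig (Site d)))] :=
  mem_disjointOccurrenceList_of_walks₅ c.W₁ c.W₂ c.W₃ c.W₄ c.W₅ c.d₁₂ c.d₁₃ c.d₁₄ c.d₁₅ c.d₂₃ c.d₂₄ c.d₂₅
    c.d₃₄ c.d₃₅ c.d₄₅

/-- … hence in `ω` itself (the events are increasing). [cite: FitznerVanDerHofstad2017, (4.66) (arXiv:1506.07977v2 p. 44)] -/
theorem mem_disjointOccurrenceList (c : LaceCodingιI ω e y y' w z) :
    ω ∈ disjointOccurrenceList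
      [openConn 0 e, openConn e w, openConn w y, openConn w z, (openConn e y : Set (BondConfig (Site d)))] :=
  isUpperSet_disjointOccurrenceList
    (fun A hA => by
      simp only [List.mem_cons, List.not_mem_nil, or_false] at hA
      rcases hA with rfl | rfl | rfl | rfl | rfl <;> exact isUpperSet_openConn _ _)
    Set.sdiff_subset c.sdiff_mem_disjointOccurrenceList

/-- **`F^{ι,I}_0((y,y'),w,z)` occurs** ((4.66)) as soon as `z ≠ y` and `b_ι = (0,e)` is vacant (given `y' ∉ C̃₀`).
[cite: FitznerVanDerHofstad2017, (4.66) and (4.69) (arXiv:1506.07977v2 p. 44)] -/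
theorem mem_eventFiotaI (c : LaceCodingιI ω e y y' w z) (hy' : y' ∉ restrCluster y y' 0 ω) (hzy : z ≠ y)
    (hvac : s(0, e) ∉ ω) : ω ∈ eventFiotaI e y y' w z := by
  refine ⟨⟨c.mem_disjointOccurrenceList, ?_⟩, hvac⟩
  simp only [Set.mem_setOf_eq, Sym2.mem_iff, not_or]
  exact ⟨hzy, (c.ne_of_notMem hy').2⟩

end LaceCodingιI

namespace LaceCodingιII

variable {ω : BondConfig (Site d)} {e y y' w z : Site d}

/-- `w₀ ∈ C̃₀`. [cite: FitznerVanDerHofstad2017, §4.4 after (4.65) (arXiv:1506.07977v2 p. 43)] -/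
theorem w_mem (c : LaceCodingιII ω e y y' w z) : w ∈ restrCluster y y' 0 ω :=
  LaceCoding₀.mem_restrCluster_of_walk c.W₁ (LaceCoding₀.zero_mem_restrCluster ω y y') w c.W₁.end_mem_support

/-- `e_ι ∈ C̃₀`. [cite: FitznerVanDerHofstad2017, §4.4 after (4.65) (arXiv:1506.07977v2 p. 43)] -/
theorem e_mem (c : LaceCodingιII ω e y y' w z) : e ∈ restrCluster y y' 0 ω :=
  LaceCoding₀.mem_restrCluster_of_walk c.W₂ c.w_mem e c.W₂.end_mem_support

/-- **All five coded connections live inside `C̃₀`** (vertices).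
[cite: FitznerVanDerHofstad2017, §4.4 after (4.65) (arXiv:1506.07977v2 p. 43)] -/
theorem mem_restrCluster_of_mem_support (c : LaceCodingιII ω e y y' w z) (x : Site d)
    (hx : x ∈ c.W₁.support ∨ x ∈ c.W₂.support ∨ x ∈ c.W₃.support ∨ x ∈ c.W₄.support ∨ x ∈ c.W₅.support) :
    x ∈ restrCluster y y' 0 ω := by
  rcases hx with hx | hx | hx | hx | hx
  · exact LaceCoding₀.mem_restrCluster_of_walk c.W₁ (LaceCoding₀.zero_mem_restrCluster ω y y') x hx
  · exact LaceCoding₀.mem_restrCluster_of_walk c.W₂ c.w_mem x hx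
  · exact LaceCoding₀.mem_restrCluster_of_walk c.W₃ c.e_mem x hx
  · exact LaceCoding₀.mem_restrCluster_of_walk c.W₄ c.e_mem x hx
  · exact LaceCoding₀.mem_restrCluster_of_walk c.W₅ c.w_mem x hx

/-- **All five coded connections live inside `C̃₀`** (bonds: both endpoints of every bond used).
[cite: FitznerVanDerHofstad2017, §4.4 after (4.65) (arXiv:1506.07977v2 p. 43)] -/
theorem mem_restrCluster_of_mem_edges (c : LaceCodingιII ω e y y' w z) (b : Sym2 (Site d))
    (hb : b ∈ c.W₁.edges ∨ b ∈ c.W₂.edges ∨ b ∈ c.W₃.edges ∨ b ∈ c.W₄.edges ∨ b ∈ c.W₅.edges) :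
    ∀ x ∈ b, x ∈ restrCluster y y' 0 ω := by
  rcases hb with hb | hb | hb | hb | hb
  · exact mem_restrCluster_of_mem_edges_of_walk c.W₁ (LaceCoding₀.zero_mem_restrCluster ω y y') b hb
  · exact mem_restrCluster_of_mem_edges_of_walk c.W₂ c.w_mem b hb
  · exact mem_restrCluster_of_mem_edges_of_walk c.W₃ c.e_mem b hb
  · exact mem_restrCluster_of_mem_edges_of_walk c.W₄ c.e_mem b hb
  · exact mem_restrCluster_of_mem_edges_of_walk c.W₅ c.w_mem b hb

/-- `w ≠ y'` and `z ≠ y'` when `y' ∉ C̃₀`. [cite: FitznerVanDerHofstad2017, (4.67) clause `z₁ ∉ b₀` (arXiv:1506.07977v2 p. 44)] -/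
theorem ne_of_notMem (c : LaceCodingιII ω e y y' w z) (hy' : y' ∉ restrCluster y y' 0 ω) : w ≠ y' ∧ z ≠ y' :=
  ⟨fun h => hy' (h ▸ c.w_mem),
   fun h => hy' (h ▸ LaceCoding₀.mem_restrCluster_of_walk c.W₅ c.w_mem z c.W₅.end_mem_support)⟩

/-- **"`F^{ι,II}_0` can occur for `a = 1` only when `u = e_ι`"**: if the bond `(y,w)` is open (in `ω`) then
`y = e` (given `y' ∉ C̃₀`, so that `w ≠ y'` and the bond is not `b₀`).
[cite: FitznerVanDerHofstad2017, §6.1 proof of Lemma 5.3, Case a = 1 (arXiv:1506.07977v2 p. 59)] -/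
theorem eq_of_mem (c : LaceCodingιII ω e y y' w z) (hy' : y' ∉ restrCluster y y' 0 ω) (h : s(y, w) ∈ ω) :
    y = e :=
  c.canon ⟨h, fun hb => (c.ne_of_notMem hy').1 (Sym2.congr_right.1 (Set.mem_singleton_iff.1 hb))⟩

/-- The five coded connections occur disjointly in `ω ∖ {(y,y')}`.
[cite: FitznerVanDerHofstad2017, (4.67) (arXiv:1506.07977v2 p. 44)] -/
theorem sdiff_mem_disjointOccurrenceList (c : LaceCodingιII ω e y y' w z) :
    ω \ {s(y, y')} ∈ disjointOccurrenceList
      [openConn 0 w, openConn w e, openConn e y, openConn e y, (openConn w z : Set (BondConfig (Site d)))] :=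
  mem_disjointOccurrenceList_of_walks₅ c.W₁ c.W₂ c.W₃ c.W₄ c.W₅ c.d₁₂ c.d₁₃ c.d₁₄ c.d₁₅ c.d₂₃ c.d₂₄ c.d₂₅
    c.d₃₄ c.d₃₅ c.d₄₅

/-- … hence in `ω` itself (the events are increasing). [cite: FitznerVanDerHofstad2017, (4.67) (arXiv:1506.07977v2 p. 44)] -/
theorem mem_disjointOccurrenceList (c : LaceCodingιII ω e y y' w z) :
    ω ∈ disjointOccurrenceList
      [openConn 0 w, openConn w e, openConn e y, openConn e y, (openConn w z : Set (BondConfig (Site d)))] :=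
  isUpperSet_disjointOccurrenceList
    (fun A hA => by
      simp only [List.mem_cons, List.not_mem_nil, or_false] at hA
      rcases hA with rfl | rfl | rfl | rfl | rfl <;> exact isUpperSet_openConn _ _)
    Set.sdiff_subset c.sdiff_mem_disjointOccurrenceList

/-- **`F^{ι,II}_0((y,y'),w,z)` occurs** ((4.67)) as soon as `z ≠ y` and `b_ι = (0,e)` is vacant (given `y' ∉ C̃₀`).
[cite: FitznerVanDerHofstad2017, (4.67) and (4.69) (arXiv:1506.07977v2 p. 44)] -/
theorem mem_eventFiotaII (c : LaceCodingιII ω e y y' w z) (hy' : y' ∉ restrCluster y y' 0 ω) (hzy : z ≠ y)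
    (hvac : s(0, e) ∉ ω) : ω ∈ eventFiotaII e y y' w z := by
  refine ⟨⟨⟨c.mem_disjointOccurrenceList, c.ne⟩, ?_⟩, hvac⟩
  simp only [Set.mem_setOf_eq, Sym2.mem_iff, not_or]
  exact ⟨hzy, (c.ne_of_notMem hy').2⟩

end LaceCodingιII

/-! ### C. The coding lemma -/

/-- **The coding, from the three key paths.**  Given, in `ω ∖ {(y,y')}`, a simple path `R : 0 → e`, two
simple paths `S₁, S₂ : e → y`, the three pairwise edge-disjoint, an open walk `S : 0 → z`, and the cut
property "every open `0`–`y` walk visits `e`": with `w :=` the last vertex of `S` on `R ∪ S₁ ∪ S₂`, the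
configuration is coded by `F^{ι,I}_0` (`w` on the sausage `S₁ ∪ S₂`) or by `F^{ι,II}_0` (`w ∈ R` off the sausage).
[cite: FitznerVanDerHofstad2017, text after (4.69) (arXiv:1506.07977v2 p. 44; EJP 22 (2017) no. 43 p. 41)] -/
theorem exists_laceCodingι_of_paths {ω : BondConfig (Site d)} {e y y' z : Site d}
    (hthr : ∀ q : (openGraph (ω \ {s(y, y')})).Walk 0 y, e ∈ q.support)
    (R : (openGraph (ω \ {s(y, y')})).Walk 0 e) (S₁ S₂ : (openGraph (ω \ {s(y, y')})).Walk e y)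
    (hR : R.IsPath) (hS₁ : S₁.IsPath) (hS₂ : S₂.IsPath) (d₁ : List.Disjoint R.edges S₁.edges)
    (d₂ : List.Disjoint R.edges S₂.edges) (d₁₂ : List.Disjoint S₁.edges S₂.edges)
    (S : (openGraph (ω \ {s(y, y')})).Walk 0 z) :
    ∃ w : Site d, Nonempty (LaceCodingιI ω e y y' w z) ∨ Nonempty (LaceCodingιII ω e y y' w z) := by
  classical
  -- the exit point `w` of `S` from `R ∪ S₁ ∪ S₂`, and the exit walk `T : w → z`
  obtain ⟨w, -, T, -, hwD, hlast⟩ := exists_append_last_mem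
    {x | x ∈ R.support ∨ x ∈ S₁.support ∨ x ∈ S₂.support} S
    ⟨0, S.start_mem_support, Or.inl R.start_mem_support⟩
  have hT : ∀ {c c' : Site d} (X : (openGraph (ω \ {s(y, y')})).Walk c c'),
      (∀ x ∈ X.support, x ∈ R.support ∨ x ∈ S₁.support ∨ x ∈ S₂.support) → List.Disjoint X.edges T.edges :=
    fun X hX => LaceGraph.edges_disjoint_of_support T X fun x hx hxX => hlast x hx (hX x hxX)
  -- Case `F^{ι,I}_0`: `w` on the branch `X` of the sausage
  have hI : ∀ (X X' : (openGraph (ω \ {s(y, y')})).Walk e y), X.IsPath → List.Disjoint R.edges X.edges →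
      List.Disjoint R.edges X'.edges → List.Disjoint X.edges X'.edges →
      (∀ x ∈ X.support, x ∈ R.support ∨ x ∈ S₁.support ∨ x ∈ S₂.support) →
      (∀ x ∈ X'.support, x ∈ R.support ∨ x ∈ S₁.support ∨ x ∈ S₂.support) → w ∈ X.support →
      ∃ w : Site d, Nonempty (LaceCodingιI ω e y y' w z) ∨ Nonempty (LaceCodingιII ω e y y' w z) := by
    intro X X' hX dRX dRX' dXX' hXD hX'D hwX
    obtain ⟨X₁, X₂, hX12⟩ := Walk.mem_support_iff_exists_append.1 hwX
    have hXsub := support_pieces_subset hX12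
    have dX := edges_disjoint_of_isPath_append hX hX12
    have dRX₁₂ := edges_disjoint_pieces hX12 dRX.symm
    have dXX'₁₂ := edges_disjoint_pieces hX12 dXX'
    have canon : y = e → w = e := by
      intro hye
      subst hye
      rw [Walk.nil_iff_support_eq.1 (Walk.isPath_iff_nil.1 hX), List.mem_singleton] at hwX
      exact hwX
    exact ⟨w, Or.inl ⟨⟨R, X₁, X₂, T, X', dRX₁₂.1.symm, dRX₁₂.2.symm, hT R fun x hx => Or.inl hx, dRX', dX,
      hT X₁ fun x hx => hXD x (hXsub.1 x hx), dXX'₁₂.1, hT X₂ fun x hx => hXD x (hXsub.2 x hx), dXX'₁₂.2,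
      (hT X' hX'D).symm, canon⟩⟩⟩
  -- Case `F^{ι,II}_0`: `w ∈ R` off the sausage
  have hII : w ∈ R.support → w ∉ S₁.support → w ∉ S₂.support →
      ∃ w : Site d, Nonempty (LaceCodingιI ω e y y' w z) ∨ Nonempty (LaceCodingιII ω e y y' w z) := by
    intro hwR hw₁ hw₂
    obtain ⟨R₁, R₂, hR12⟩ := Walk.mem_support_iff_exists_append.1 hwR
    have hRsub := support_pieces_subset hR12
    have hwe : w ≠ e := fun h => hw₁ (h ▸ S₁.start_mem_support)
    have hwy : w ≠ y := fun h => hw₁ (h ▸ S₁.end_mem_support)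
    have dR := edges_disjoint_of_isPath_append hR hR12
    have dR₁₂S₁ := edges_disjoint_pieces hR12 d₁
    have dR₁₂S₂ := edges_disjoint_pieces hR12 d₂
    -- an open bond `(y, w)` with `y ≠ e` would join `0` to `y` around `e`
    have canon : s(y, w) ∈ ω \ {s(y, y')} → y = e := by
      intro hb
      by_contra hye
      have hadj : (openGraph (ω \ {s(y, y')})).Adj w y :=
        (openGraph_adj _ w y).2 ⟨by rw [Sym2.eq_swap (a := w) (b := y)]; exact hb, hwy⟩
      have he := hthr (R₁.concat hadj)
      rw [Walk.support_concat, List.mem_append, List.mem_singleton] at he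
      rcases he with he | he
      · obtain ⟨-, -, hmeet⟩ := LaceGraph.isPath_of_append (hR12 ▸ hR)
        exact hwe (hmeet e he R₂.end_mem_support).symm
      · exact hye he.symm
    exact ⟨w, Or.inr ⟨⟨R₁, R₂, S₁, S₂, T, dR, dR₁₂S₁.1, dR₁₂S₂.1, hT R₁ fun x hx => Or.inl (hRsub.1 x hx),
      dR₁₂S₁.2, dR₁₂S₂.2, hT R₂ fun x hx => Or.inl (hRsub.2 x hx), d₁₂, hT S₁ fun x hx => Or.inr (Or.inl hx),
      hT S₂ fun x hx => Or.inr (Or.inr hx), hwe, hwy, canon⟩⟩⟩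
  by_cases hw₁ : w ∈ S₁.support
  · exact hI S₁ S₂ hS₁ d₁ d₂ d₁₂ (fun x hx => Or.inr (Or.inl hx)) (fun x hx => Or.inr (Or.inr hx)) hw₁
  by_cases hw₂ : w ∈ S₂.support
  · exact hI S₂ S₁ hS₂ d₂ d₁ d₁₂.symm (fun x hx => Or.inr (Or.inr hx)) (fun x hx => Or.inr (Or.inl hx)) hw₂
  have hwR : w ∈ R.support := by
    rcases hwD with h | h | h
    exacts [h, absurd h hw₁, absurd h hw₂]
  exact hII hwR hw₁ hw₂

/-- **The coding lemma of level `0` for the cell `E'(0,y;{e})`** (the level-`0` cell of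
`Ξ^{b_ι}(0,x;{e_ι})`, read on any configuration — in the application `ω = (ω₀)_{b_ιᶜ}`).  For a
configuration using bonds of `ℤ^d` with `ω ∈ E'(0,y;{e})`, `y' ∉ C̃^{(y,y')}(0)` and `z ∈ C̃^{(y,y')}(0)`
there is `w` such that `ω` is coded by `F^{ι,I}_0((y,y'),w,z)` (with `y = e → w = e`) or by
`F^{ι,II}_0((y,y'),w,z)` (with `w ≠ e`, `w ≠ y`, and the bond `(y,w)` open only if `y = e`), all coded
walks open in `ω ∖ {(y,y')}` and pairwise bond-disjoint.
[cite: FitznerVanDerHofstad2017, (4.69) and the text after it (arXiv:1506.07977v2 p. 44; EJP 22 (2017) no. 43 p. 41); §4.4 after (4.65) (p. 43); §6.1 proof of Lemma 5.3 (p. 59)] -/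
theorem exists_laceCodingι {ω : BondConfig (Site d)} (hω : ω ⊆ (zdGraph d).edgeSet) {e y y' z : Site d}
    (hE : ω ∈ laceE {e} 0 y) (hy' : y' ∉ restrCluster y y' 0 ω) (hz : z ∈ restrCluster y y' 0 ω) :
    ∃ w : Site d, Nonempty (LaceCodingιI ω e y y' w z) ∨ Nonempty (LaceCodingιII ω e y y' w z) := by
  classical
  have hEγ := sdiff_mem_laceE_of_notMem hE hy'
  have hγ : ω \ {s(y, y')} ⊆ (zdGraph d).edgeSet := Set.sdiff_subset.trans hω
  obtain ⟨S⟩ := (mem_restrCluster_iff y y' 0 z ω).1 hz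
  -- the last sausage of `E'(0,y;{e})` in `ω ∖ {(y,y')}`: both branches through `e`
  obtain ⟨t, B, P, Q, -, hP, hQ, hBP, hBQ, hPQ, ⟨e₁, heP₁, he₁⟩, ⟨e₂, heQ₂, he₂⟩⟩ :=
    exists_sausage_of_mem_laceE hγ hEγ
  have heP : e ∈ P.support := by rw [Set.mem_singleton_iff] at he₁; exact he₁ ▸ heP₁
  have heQ : e ∈ Q.support := by rw [Set.mem_singleton_iff] at he₂; exact he₂ ▸ heQ₂
  obtain ⟨P₁, P₂, hP12⟩ := Walk.mem_support_iff_exists_append.1 heP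
  obtain ⟨Q₁, Q₂, hQ12⟩ := Walk.mem_support_iff_exists_append.1 heQ
  obtain ⟨-, hP₂, -⟩ := LaceGraph.isPath_of_append (hP12 ▸ hP)
  obtain ⟨-, hQ₂, -⟩ := LaceGraph.isPath_of_append (hQ12 ▸ hQ)
  have dP := edges_disjoint_of_isPath_append hP hP12
  have dP₂B := (edges_disjoint_pieces hP12 hBP.symm).2
  have dQ₂B := (edges_disjoint_pieces hQ12 hBQ.symm).2
  have dQ₂P := (edges_disjoint_pieces hQ12 hPQ.symm).2
  have dPQ₂ := edges_disjoint_pieces hP12 dQ₂P.symm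
  -- `R`: a simple `0 → e` path inside the walk `B·P₁`, edge-disjoint from `P₂`, `Q₂`
  have hWe : (B.append P₁).edges = B.edges ++ P₁.edges := Walk.edges_append _ _
  have dWP₂ : List.Disjoint (B.append P₁).edges P₂.edges := by
    rw [hWe]; exact List.disjoint_append_left.2 ⟨dP₂B.symm, dP⟩
  have dWQ₂ : List.Disjoint (B.append P₁).edges Q₂.edges := by
    rw [hWe]; exact List.disjoint_append_left.2 ⟨dQ₂B.symm, dPQ₂.1⟩
  exact exists_laceCodingι_of_paths (mem_support_of_mem_laceE_singleton hEγ) (B.append P₁).bypass P₂ Q₂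
    (B.append P₁).bypass_isPath hP₂ hQ₂
    (List.disjoint_of_subset_left (B.append P₁).edges_bypass_subset_edges dWP₂)
    (List.disjoint_of_subset_left (B.append P₁).edges_bypass_subset_edges dWQ₂) dPQ₂.2 S

/-- Corollary in the shape of `NobleBoundingEventsIota.exists_mem_eventFiota_of_mem_laceE`, with the
canonical side facts: for `z ≠ y` and `b_ι = (0,e)` vacant, `ω ∈ F^{ι,I}_0((y,y'),w,z)` with
`y = e → w = e`, or `ω ∈ F^{ι,II}_0((y,y'),w,z)` with `w ≠ y` and (`(y,w)` open `→ y = e`).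
[cite: FitznerVanDerHofstad2017, (4.66), (4.67), (4.69) (arXiv:1506.07977v2 p. 44); §6.1 proof of Lemma 5.3 (p. 59)] -/
theorem exists_mem_eventFiota_canonical {ω : BondConfig (Site d)} (hω : ω ⊆ (zdGraph d).edgeSet)
    {e y y' z : Site d} (hE : ω ∈ laceE {e} 0 y) (hy' : y' ∉ restrCluster y y' 0 ω)
    (hz : z ∈ restrCluster y y' 0 ω) (hzy : z ≠ y) (hvac : s(0, e) ∉ ω) :
    ∃ w : Site d, (ω ∈ eventFiotaI e y y' w z ∧ (y = e → w = e)) ∨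
      (ω ∈ eventFiotaII e y y' w z ∧ w ≠ y ∧ (s(y, w) ∈ ω → y = e)) := by
  obtain ⟨w, hw⟩ := exists_laceCodingι hω hE hy' hz
  rcases hw with ⟨⟨c⟩⟩ | ⟨⟨c⟩⟩
  · exact ⟨w, Or.inl ⟨c.mem_eventFiotaI hy' hzy hvac, c.canon⟩⟩
  · exact ⟨w, Or.inr ⟨c.mem_eventFiotaII hy' hzy hvac, c.ne_end, c.eq_of_mem hy'⟩⟩

end Literature.Probability.FitznerVanDerHofstad2017
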